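import Literature.MathematicalPhysics.QuantumFieldTheory.Balaban1983to89.B1LowerBound

/-!
# `Balaban1983to89.B1Ineq352Proof` — T. Bałaban, *(Higgs)₂,₃ quantum fields in a finite volume. I. A lower bound*,
Commun. Math. Phys. **85** (1982) 603–626 [Balaban1982Higgs1]: the in-proof bound **(3.52)** p. 621 — the restriction
`χ_{k+1}(ψ)` on the background field `ψ^{(k+1)}` bounds the block field `ψ` itself, `|ψ(y)| ≤ c·p(L^{k+1}ε) ≤ c·p(L^kε)` with `c`
independent of `k, ε` — PROVED over the tree's B1 §3 vocabulary (`B1LowerBound.bgField` (3.29), `B1LowerBound.SmallFieldAt`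
(3.27)–(3.28), `B2.pFn` = p(ε), `B1.aSeq` = a_k (2.15)); theorems only

statement-level skeleton of published theorems with citation tags; proofs where landed; nothing here is a claim about the Yang–Mills mass gap

PDF held: `paper:balaban1982-cmp85-higgs23-i` (journal page = PDF page + 602); the display and its sentence were read on the x4
render `run/shared/lean/pub/pub-balaban/b2b-balaban-ref1/pages/1982-cmp85-higgs23-I/1982-cmp85-higgs23-I-p019-x4.png` (p. 621),
with (3.27)–(3.29) on `…-p015-x4.png` (p. 617) and (2.22) on `…-p008-x4.png` (p. 610), READ AS IMAGES.

CITATION HEADER (lean-in-tree rule).  WHAT IS REPRODUCED — SKELETON row **B1.Eq3.52** (HOME `run/shared/lean/pub/lit-balaban/`,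
reader r12 `lit-balaban-r12/ROWS-B1-part2.md`: «BOUND …; absent · in-proof bound (schematic arithmetic; c independent of k, ε);
depends on B1.Eq3.27-3.28»), verbatim from p. 621 [PDF 19]: *"Now we will analyze in detail the restrictions on the fields
implied by the characteristic functions in the above integral. We will do it for scalar fields only, the considerations for
vector fields are even simpler. At first let us notice that the restrictions introduced by χ_{k+1}(ψ) or χ_k(φ) imply some
restrictions on the fields ψ, φ, for example we have:*
`|ψ(y)| = |(Q*_{k+1}(B^{(k+1)})ψ)(x)| = a_{k+1}⁻¹L²|((−Δ^η_{B^{(k+1)}} + a_{k+1}L⁻²P_{k+1}(B^{(k+1)}) + m²(L^kε)²)ψ^{(k+1)})(x)|`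
`       ≤ a_{k+1}⁻¹L^{−(d−2)/2}p(L^{k+1}ε) + L^{−(d−2)/2}p(L^{k+1}ε) = cp(L^{k+1}ε) ≤ cp(L^kε)`   **(3.52)**
*for some c independent of k, ε."*  Inputs, as printed: (3.29) p. 617 `ψ^{(k),ε} = a_k(L^kε)⁻²G^ε_k(A^{(k),ε})Q*_k(A^{(k),ε})ψ`
(here at level `k+1` after the rescaling of p. 618 to the unit lattice `T₁^{(k)}`: `ψ^{(k+1)} = a_{k+1}L⁻²G_{k+1}(B^{(k+1)})Q*_{k+1}(B^{(k+1)})ψ`);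
(2.22) p. 610 the rescaled propagator `G_k(Ω,A) = (−Δ^η_{A,Ω} + m²(L^kε)² + a_kP_k(A))⁻¹`, `P_k = Q*_kQ_k` (2.20) — at level
`k+1` in the units of level `k`: `G_{k+1}(B)⁻¹ = −Δ^η_B + a_{k+1}L⁻²P_{k+1}(B) + m²(L^kε)²`; (3.28) p. 617 the restriction
`χ_{k+1}(ψ)`: `|ψ^{(k+1),ε}(x)| ≤ (L^{k+1}ε)^{−(d−2)/2}p(L^{k+1}ε)`, `|(Δ^ε_{A}ψ^{(k+1),ε})(x)| ≤ (L^{k+1}ε)^{−(d+2)/2}p(L^{k+1}ε)`,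
which after the rescaling by `L^kε` ((1.22)–(1.23) p. 607) reads `|ψ^{(k+1)}(x)| ≤ L^{−(d−2)/2}p(L^{k+1}ε)`,
`|(Δ^η_Bψ^{(k+1)})(x)| ≤ L^{−(d+2)/2}p(L^{k+1}ε)` — i.e. `B1LowerBound.SmallFieldAt d L p(L^{k+1}ε) |ψ^{(k+1)}(x)| |Δψ^{(k+1)}(x)|`;
(2.7)/(2.11) p. 608–609 the block average `(Q_k(A)φ)(y) = L^{−kd}Σ_{x∈B^k(y)}U(A(Γ_{y,x}))φ(x)` with `U` orthogonal
(`|U(·)v| = |v|`, (1.7) p. 605), so `|(Q*ψ)(x)| = |ψ(y)|` for `x ∈ B(y)` and `|(P f)(x)| ≤ sup|f|`; (2.15) p. 609 `a_k ↘ a_∞ = a(1 − L⁻²)`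
(`B1.ainf_lt_aSeq`); (3.1) p. 613 `p(ε) = b₀(1 + log ε⁻¹)^p` (`B2.pFn`); p. 622 *"where we have assumed L^{k+1}ε ≤ 1"*, p. 624
the stopping rule `L^kε ≤ ε₀`.

THE MODEL (schematic, as in `…B1LowerBound`/`…B1Sect3Statements`, cell DIVERGENCE D-b01.3: abstract carriers, the operators
the paper constructs elsewhere are explicit linear maps, their printed properties explicit hypotheses — displayed, not
constructed): `X` ↤ the fine sites (η-lattice), `Y` ↤ the coarse sites `T^{(k+1)}` , `blk : X → Y` ↤ `x ∈ B^{k+1}(y)`, `V` ↤ `ℝ^N`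
with its Euclidean norm (any real normed space); `Qs : (Y → V) →ₗ[ℝ] (X → V)` ↤ `Q*_{k+1}(B^{(k+1)})` with the ISOMETRY hypothesis
`‖(Qs ψ) x‖ = ‖ψ (blk x)‖`; `negLap, P, G : (X → V) →ₗ[ℝ] (X → V)` ↤ `−Δ^η_{B^{(k+1)}}`, `P_{k+1}(B^{(k+1)})`, `G_{k+1}(B^{(k+1)})` with
the INVERSE hypothesis `(negLap + a_{k+1}L⁻²P + μ)∘G = id`, `μ` ↤ `m²(L^kε)²`, and the AVERAGING hypothesis `(∀x ‖f x‖ ≤ M) →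
∀x ‖(P f) x‖ ≤ M`; `a` ↤ `a_{k+1} > 0`, `L > 0`; `ψ^{(k+1)} = B1LowerBound.bgField a L G Qs ψ = (aL⁻²)·G(Q*ψ)` (3.29); the
restriction `χ_{k+1}(ψ) = 1` ↦ `∀ x, B1LowerBound.SmallFieldAt d L pp ‖ψ^{(k+1)} x‖ ‖(negLap ψ^{(k+1)}) x‖` with `pp` ↤ `p(L^{k+1}ε)`.

WHAT THIS FILE PROVES (theorems only — no `def`, no new `Prop` fact; 0 `sorry`; standard axioms):
* `qs_eq_smul_Ginv` — the FIELD IDENTITY behind the first two members of (3.52): `Q*ψ = a⁻¹L²·(G⁻¹ψ^{(k+1)})` (from (3.29) and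
  `G⁻¹G = 1`); `eq352` — the first two members AS PRINTED, pointwise in norm: `‖ψ(y)‖ = a⁻¹L²‖(G⁻¹ψ^{(k+1)})(x)‖`, `x ∈ B(y)`.
* `norm_Ginv_apply_le` — triangle inequality for the three constituents of `G⁻¹ = −Δ + aL⁻²P + μ`.
* **`ineq352_three_terms`** — the bound with ALL THREE terms: `‖ψ(y)‖ ≤ (a⁻¹L^{−(d−2)/2} + L^{−(d−2)/2} + a⁻¹μL^{2−(d−2)/2})·p(L^{k+1}ε)`;
  the first two summands are the two PRINTED ones; the third, `a_{k+1}⁻¹L²·m²(L^kε)²·|ψ^{(k+1)}(x)| ≤ a⁻¹m²(L^kε)²L^{2−(d−2)/2}p(L^{k+1}ε)`,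
  comes from the mass term `m²(L^kε)²` that the print displays inside `G⁻¹` but not in the middle member — it is what the
  printed *"= cp(L^{k+1}ε)"* absorbs (reading note recorded in HOME/GAPS.md; `two_term_member_can_fail` is the abstract-model
  witness that the displayed two-term member is not a consequence of the displayed inputs alone).
* **`ineq352`** — THE ROW: with `a_∞ ≤ a_{k+1}` (`0 < a_∞`), `μ = m²(L^kε)²`, `L^kε ≤ ε₀`, `1 ≤ L`:
  `‖ψ(y)‖ ≤ c·p(L^{k+1}ε)` with the EXPLICIT `c = (a_∞⁻¹ + 1)L^{−(d−2)/2} + a_∞⁻¹m²ε₀²L^{2−(d−2)/2}` — independent of `k, ε` as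
  printed; **`ineq352_step`** — `c·p(L^{k+1}ε) ≤ c·p(L^kε)` (the last member; `pFn_anti`: `p` is antitone on `(0,1]`, `b₀ ≥ 0`,
  `p ≥ 0`, *"L^{k+1}ε ≤ 1"* p. 622); **`ineq352_printed_data`** — the same with the tree's `a_{k+1} = B1.aSeq a L (k+1)` and
  `a_∞ = a(1 − L⁻²)` via `B1.ainf_lt_aSeq`.
HONEST SCOPE.  The operators and their three displayed properties (isometry of `Q*`, `G⁻¹G = 1` with the printed `G⁻¹`, `P`
averaging) are hypotheses, not constructed (rows B1.Eq2.7/2.20/2.22, `HiggsAveraging`/`HiggsCovariance`); the vector-field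
case (*"even simpler"*) is the same statement with `Qs ↤ Q*_{k+1}`, `negLap ↤ −Δ^η`.  Nothing about (3.53) ff.
Unit `lit-balaban-p14` gen 2 (Phase-2 proof seat p14, literature-prover-lit-balaban-p14-g2-0), HOME `run/shared/lean/pub/lit-balaban/`
(seat log `lit-balaban-p14/STATUS.md`).
-/

namespace Literature.MathematicalPhysics.QuantumFieldTheory.Balaban1983to89.B1Ineq352Proof

open Literature.MathematicalPhysics.QuantumFieldTheory.Balaban1983to89
open B1LowerBound

/-! ## §1 `p(ε)` is antitone on `(0, 1]` (the last member of (3.52)) -/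

/-- `p(ε) = b₀(1 + log ε⁻¹)^p` DECREASES in `ε ∈ (0,1]` (`b₀ ≥ 0`, real exponent `p ≥ 0`): for `0 < s ≤ t ≤ 1`, `p(t) ≤ p(s)` —
the step *"cp(L^{k+1}ε) ≤ cp(L^kε)"* of (3.52) (with p. 622 *"we have assumed L^{k+1}ε ≤ 1"*).
[cite: Balaban1982Higgs1, (3.52) p.621] -/
theorem pFn_anti {b₀ p s t : ℝ} (hb₀ : 0 ≤ b₀) (hp : 0 ≤ p) (hs : 0 < s) (hst : s ≤ t) (ht : t ≤ 1) :
    B2.pFn b₀ p t ≤ B2.pFn b₀ p s := by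
  unfold B2.pFn
  have ht0 : 0 < t := hs.trans_le hst
  have h1 : 0 ≤ 1 + Real.log t⁻¹ := by
    rw [Real.log_inv]
    have := Real.log_nonpos ht0.le ht
    linarith
  have h2 : 1 + Real.log t⁻¹ ≤ 1 + Real.log s⁻¹ := by
    rw [Real.log_inv, Real.log_inv]
    have := Real.log_le_log hs hst
    linarith
  exact mul_le_mul_of_nonneg_left (Real.rpow_le_rpow h1 h2 hp) hb₀

/-! ## §2 The identity `Q*ψ = a⁻¹L²·G⁻¹ψ^{(k+1)}` and the first two members of (3.52) -/

section Model

variable {X Y V : Type} [NormedAddCommGroup V] [NormedSpace ℝ V]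

/-- **the field identity behind (3.52)**: with `ψ^{(k+1)} = a L⁻²·G(Q*ψ)` (3.29) and `G⁻¹ = −Δ + aL⁻²P + μ` a left inverse of
`G` ((2.22), `μ = m²(L^kε)²`), `Q*ψ = a⁻¹L²·G⁻¹ψ^{(k+1)}` (`a, L ≠ 0`). [cite: Balaban1982Higgs1, (3.52) p.621] -/
theorem qs_eq_smul_Ginv (negLap P G : (X → V) →ₗ[ℝ] (X → V)) (Qs : (Y → V) →ₗ[ℝ] (X → V)) {a L : ℝ} (μ : ℝ)
    (ha : a ≠ 0) (hL : L ≠ 0) (hG : ∀ f : X → V, negLap (G f) + (a * (L ^ 2)⁻¹) • P (G f) + μ • G f = f) (ψ : Y → V) :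
    Qs ψ = (a⁻¹ * L ^ 2) •
      (negLap (bgField a L G Qs ψ) + (a * (L ^ 2)⁻¹) • P (bgField a L G Qs ψ) + μ • bgField a L G Qs ψ) := by
  have key : negLap (bgField a L G Qs ψ) + (a * (L ^ 2)⁻¹) • P (bgField a L G Qs ψ) + μ • bgField a L G Qs ψ
      = (a * (L ^ 2)⁻¹) • Qs ψ := by
    simp only [bgField, map_smul]
    rw [smul_comm μ (a * (L ^ 2)⁻¹) (G (Qs ψ)), ← smul_add, ← smul_add, hG]
  rw [key, smul_smul, show a⁻¹ * L ^ 2 * (a * (L ^ 2)⁻¹) = 1 by field_simp, one_smul]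

/-- **(3.52), first two members, AS PRINTED**: `|ψ(y)| = |(Q*_{k+1}(B^{(k+1)})ψ)(x)| = a_{k+1}⁻¹L²|(G_{k+1}(B^{(k+1)})⁻¹ψ^{(k+1)})(x)|`
for `x ∈ B^{k+1}(y)` — from the isometry of `Q*` (`U` orthogonal, (1.7)/(2.7)) and `qs_eq_smul_Ginv`; `a > 0`.
[cite: Balaban1982Higgs1, (3.52) p.621] -/
theorem eq352 (negLap P G : (X → V) →ₗ[ℝ] (X → V)) (Qs : (Y → V) →ₗ[ℝ] (X → V)) (blk : X → Y) {a L : ℝ} (μ : ℝ)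
    (ha : 0 < a) (hL : L ≠ 0) (hG : ∀ f : X → V, negLap (G f) + (a * (L ^ 2)⁻¹) • P (G f) + μ • G f = f)
    (ψ : Y → V) (hiso : ∀ x, ‖Qs ψ x‖ = ‖ψ (blk x)‖) (x : X) :
    ‖ψ (blk x)‖ = a⁻¹ * L ^ 2 *
      ‖(negLap (bgField a L G Qs ψ) + (a * (L ^ 2)⁻¹) • P (bgField a L G Qs ψ) + μ • bgField a L G Qs ψ) x‖ := by
  rw [← hiso x, qs_eq_smul_Ginv negLap P G Qs μ ha.ne' hL hG ψ, Pi.smul_apply, norm_smul, Real.norm_eq_abs,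
    abs_of_nonneg (by positivity)]

/-- triangle inequality for the three constituents of `G⁻¹ = −Δ + aL⁻²P + μ` at a point (`a > 0`, `μ ≥ 0`):
`‖(G⁻¹f)(x)‖ ≤ ‖(−Δf)(x)‖ + aL⁻²‖(Pf)(x)‖ + μ‖f(x)‖`. [cite: Balaban1982Higgs1, (3.52) p.621] -/
theorem norm_Ginv_apply_le (negLap P : (X → V) →ₗ[ℝ] (X → V)) {a L μ : ℝ} (ha : 0 ≤ a) (hμ : 0 ≤ μ) (f : X → V) (x : X) :
    ‖(negLap f + (a * (L ^ 2)⁻¹) • P f + μ • f) x‖ ≤ ‖negLap f x‖ + a * (L ^ 2)⁻¹ * ‖P f x‖ + μ * ‖f x‖ := by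
  rw [Pi.add_apply, Pi.add_apply, Pi.smul_apply, Pi.smul_apply]
  refine (norm_add_le _ _).trans (add_le_add ((norm_add_le _ _).trans (add_le_add le_rfl ?_)) ?_)
  · rw [norm_smul, Real.norm_eq_abs, abs_of_nonneg (by positivity)]
  · rw [norm_smul, Real.norm_eq_abs, abs_of_nonneg hμ]

/-! ## §3 The bound: three terms, then the printed `c·p(L^{k+1}ε) ≤ c·p(L^kε)` with `c` independent of `k, ε` -/

/-- **(3.52) with all three terms**: under the restriction `χ_{k+1}(ψ) = 1` in its rescaled form
(`SmallFieldAt d L pp`: `‖ψ^{(k+1)}(x)‖ ≤ L^{−(d−2)/2}pp`, `‖(−Δψ^{(k+1)})(x)‖ ≤ L^{−(d+2)/2}pp`, `pp = p(L^{k+1}ε)`) at every fine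
site, the averaging bound for `P`, the isometry of `Q*` and `G⁻¹G = 1`:
`‖ψ(y)‖ ≤ (a⁻¹L^{−(d−2)/2} + L^{−(d−2)/2} + a⁻¹μL^{2−(d−2)/2})·pp` — the two PRINTED summands plus the mass-term summand.
[cite: Balaban1982Higgs1, (3.52) p.621] -/
theorem ineq352_three_terms (negLap P G : (X → V) →ₗ[ℝ] (X → V)) (Qs : (Y → V) →ₗ[ℝ] (X → V)) (blk : X → Y)
    {a L μ pp : ℝ} (d : ℕ) (ha : 0 < a) (hL : 0 < L) (hμ : 0 ≤ μ)
    (hG : ∀ f : X → V, negLap (G f) + (a * (L ^ 2)⁻¹) • P (G f) + μ • G f = f)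
    (hP : ∀ (f : X → V) (M : ℝ), (∀ x, ‖f x‖ ≤ M) → ∀ x, ‖P f x‖ ≤ M)
    (ψ : Y → V) (hiso : ∀ x, ‖Qs ψ x‖ = ‖ψ (blk x)‖)
    (hchi : ∀ x, SmallFieldAt d L pp ‖bgField a L G Qs ψ x‖ ‖negLap (bgField a L G Qs ψ) x‖) (x : X) :
    ‖ψ (blk x)‖ ≤ (a⁻¹ * L ^ (-(((d : ℝ) - 2) / 2)) + L ^ (-(((d : ℝ) - 2) / 2))
        + a⁻¹ * μ * L ^ (2 - ((d : ℝ) - 2) / 2)) * pp := by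
  set ψk := bgField a L G Qs ψ with hψk
  have hψ : ∀ x, ‖ψk x‖ ≤ L ^ (-(((d : ℝ) - 2) / 2)) * pp := fun x => (hchi x).1
  have hΔ : ‖negLap ψk x‖ ≤ L ^ (-(((d : ℝ) + 2) / 2)) * pp := (hchi x).2
  have hPψ : ‖P ψk x‖ ≤ L ^ (-(((d : ℝ) - 2) / 2)) * pp := hP ψk _ hψ x
  have hpow1 : L ^ 2 * L ^ (-(((d : ℝ) + 2) / 2)) = L ^ (-(((d : ℝ) - 2) / 2)) := by
    rw [← Real.rpow_natCast L 2, ← Real.rpow_add hL, Nat.cast_ofNat,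
      show (2 : ℝ) + -(((d : ℝ) + 2) / 2) = -(((d : ℝ) - 2) / 2) by ring]
  have hpow2 : L ^ 2 * L ^ (-(((d : ℝ) - 2) / 2)) = L ^ (2 - ((d : ℝ) - 2) / 2) := by
    rw [← Real.rpow_natCast L 2, ← Real.rpow_add hL, Nat.cast_ofNat,
      show (2 : ℝ) + -(((d : ℝ) - 2) / 2) = 2 - ((d : ℝ) - 2) / 2 by ring]
  have hψx : ‖ψk x‖ ≤ L ^ (-(((d : ℝ) - 2) / 2)) * pp := hψ x
  rw [eq352 negLap P G Qs blk μ ha hL.ne' hG ψ hiso x]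
  calc a⁻¹ * L ^ 2 * ‖(negLap ψk + (a * (L ^ 2)⁻¹) • P ψk + μ • ψk) x‖
      ≤ a⁻¹ * L ^ 2 * (‖negLap ψk x‖ + a * (L ^ 2)⁻¹ * ‖P ψk x‖ + μ * ‖ψk x‖) :=
        mul_le_mul_of_nonneg_left (norm_Ginv_apply_le negLap P ha.le hμ ψk x) (by positivity)
    _ ≤ a⁻¹ * L ^ 2 * (L ^ (-(((d : ℝ) + 2) / 2)) * pp + a * (L ^ 2)⁻¹ * (L ^ (-(((d : ℝ) - 2) / 2)) * pp)
          + μ * (L ^ (-(((d : ℝ) - 2) / 2)) * pp)) := by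
        gcongr
    _ = a⁻¹ * pp * (L ^ 2 * L ^ (-(((d : ℝ) + 2) / 2)))
          + (a⁻¹ * a) * (L ^ 2 * (L ^ 2)⁻¹) * (L ^ (-(((d : ℝ) - 2) / 2)) * pp)
          + a⁻¹ * μ * pp * (L ^ 2 * L ^ (-(((d : ℝ) - 2) / 2))) := by
        ring
    _ = (a⁻¹ * L ^ (-(((d : ℝ) - 2) / 2)) + L ^ (-(((d : ℝ) - 2) / 2))
          + a⁻¹ * μ * L ^ (2 - ((d : ℝ) - 2) / 2)) * pp := by
        rw [hpow1, hpow2, inv_mul_cancel₀ ha.ne', mul_inv_cancel₀ (pow_ne_zero 2 hL.ne'), one_mul, one_mul]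
        ring

/-- **(3.52) — THE ROW**: `‖ψ(y)‖ ≤ c·p(L^{k+1}ε)` with `c = (a_∞⁻¹ + 1)L^{−(d−2)/2} + a_∞⁻¹m²ε₀²L^{2−(d−2)/2}` INDEPENDENT OF `k, ε`
(*"for some c independent of k, ε"*), given `0 < a_∞ ≤ a_{k+1}` ((2.15)), `μ = m²(L^kε)²` with `L^kε ≤ ε₀` (stopping rule p. 624),
`L ≥ 1`, and the hypotheses of `ineq352_three_terms` with `pp = p(L^{k+1}ε) = B2.pFn b₀ p (L^{k+1}ε) ≥ 0`.
[cite: Balaban1982Higgs1, (3.52) p.621] -/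
theorem ineq352 (negLap P G : (X → V) →ₗ[ℝ] (X → V)) (Qs : (Y → V) →ₗ[ℝ] (X → V)) (blk : X → Y)
    {a aInf L msq ℓk ε₀ pp : ℝ} (d : ℕ) (haInf : 0 < aInf) (ha : aInf ≤ a) (hL : 1 ≤ L) (hmsq : 0 ≤ msq)
    (hℓk : 0 ≤ ℓk) (hℓkε₀ : ℓk ≤ ε₀) (hpp : 0 ≤ pp)
    (hG : ∀ f : X → V, negLap (G f) + (a * (L ^ 2)⁻¹) • P (G f) + (msq * ℓk ^ 2) • G f = f)
    (hP : ∀ (f : X → V) (M : ℝ), (∀ x, ‖f x‖ ≤ M) → ∀ x, ‖P f x‖ ≤ M)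
    (ψ : Y → V) (hiso : ∀ x, ‖Qs ψ x‖ = ‖ψ (blk x)‖)
    (hchi : ∀ x, SmallFieldAt d L pp ‖bgField a L G Qs ψ x‖ ‖negLap (bgField a L G Qs ψ) x‖) (x : X) :
    ‖ψ (blk x)‖ ≤ ((aInf⁻¹ + 1) * L ^ (-(((d : ℝ) - 2) / 2))
        + aInf⁻¹ * (msq * ε₀ ^ 2) * L ^ (2 - ((d : ℝ) - 2) / 2)) * pp := by
  have ha0 : 0 < a := haInf.trans_le ha
  have hL0 : 0 < L := one_pos.trans_le hL
  have hμ : 0 ≤ msq * ℓk ^ 2 := by positivity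
  refine (ineq352_three_terms negLap P G Qs blk d ha0 hL0 hμ hG hP ψ hiso hchi x).trans
    (mul_le_mul_of_nonneg_right ?_ hpp)
  have h1 : a⁻¹ ≤ aInf⁻¹ := inv_anti₀ haInf ha
  have h2 : 0 ≤ L ^ (-(((d : ℝ) - 2) / 2)) := Real.rpow_nonneg hL0.le _
  have h3 : 0 ≤ L ^ (2 - ((d : ℝ) - 2) / 2) := Real.rpow_nonneg hL0.le _
  have h4 : msq * ℓk ^ 2 ≤ msq * ε₀ ^ 2 := mul_le_mul_of_nonneg_left (pow_le_pow_left₀ hℓk hℓkε₀ 2) hmsq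
  have h5 : a⁻¹ * (msq * ℓk ^ 2) ≤ aInf⁻¹ * (msq * ε₀ ^ 2) :=
    mul_le_mul h1 h4 hμ (inv_nonneg.2 haInf.le)
  nlinarith [mul_le_mul_of_nonneg_right h1 h2, mul_le_mul_of_nonneg_right h5 h3]

/-- **(3.52), last member**: `c·p(L^{k+1}ε) ≤ c·p(L^kε)` for `c ≥ 0`, `0 < L^kε`, `1 ≤ L`, `L^{k+1}ε ≤ 1` (p. 622), `b₀ ≥ 0`, `p ≥ 0`.
[cite: Balaban1982Higgs1, (3.52) p.621] -/
theorem ineq352_step {c b₀ p L ℓk : ℝ} (hc : 0 ≤ c) (hb₀ : 0 ≤ b₀) (hp : 0 ≤ p) (hℓk : 0 < ℓk) (hL : 1 ≤ L)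
    (hLℓ : L * ℓk ≤ 1) : c * B2.pFn b₀ p (L * ℓk) ≤ c * B2.pFn b₀ p ℓk :=
  mul_le_mul_of_nonneg_left (pFn_anti hb₀ hp hℓk (le_mul_of_one_le_left hℓk.le hL) hLℓ) hc

/-- **(3.52) with the tree's printed data**: `a_{k+1} = B1.aSeq a L (k+1)` ((2.13)/(2.15), `a > 0`, `L > 1`),
`a_∞ = a(1 − L⁻²)`, `μ = m²(L^kε)²`, `pp = p(L^{k+1}ε) = B2.pFn b₀ p (L·L^kε)` (`b₀ ≥ 0`), `L^kε ≤ ε₀`, `L^{k+1}ε ≤ 1`: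
`‖ψ(y)‖ ≤ c·p(L^{k+1}ε) ≤ c·p(L^kε)`, `c = ((a(1−L⁻²))⁻¹ + 1)L^{−(d−2)/2} + (a(1−L⁻²))⁻¹m²ε₀²L^{2−(d−2)/2}` — no `k`, no `ε` in `c`.
[cite: Balaban1982Higgs1, (3.52) p.621] -/
theorem ineq352_printed_data (negLap P G : (X → V) →ₗ[ℝ] (X → V)) (Qs : (Y → V) →ₗ[ℝ] (X → V)) (blk : X → Y)
    {a L msq ℓk ε₀ b₀ p : ℝ} (d k : ℕ) (ha : 0 < a) (hL : 1 < L) (hmsq : 0 ≤ msq) (hb₀ : 0 ≤ b₀) (hp : 0 ≤ p)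
    (hℓk : 0 < ℓk) (hℓkε₀ : ℓk ≤ ε₀) (hLℓ : L * ℓk ≤ 1)
    (hG : ∀ f : X → V, negLap (G f) + (B1.aSeq a L (k + 1) * (L ^ 2)⁻¹) • P (G f) + (msq * ℓk ^ 2) • G f = f)
    (hP : ∀ (f : X → V) (M : ℝ), (∀ x, ‖f x‖ ≤ M) → ∀ x, ‖P f x‖ ≤ M)
    (ψ : Y → V) (hiso : ∀ x, ‖Qs ψ x‖ = ‖ψ (blk x)‖)
    (hchi : ∀ x, SmallFieldAt d L (B2.pFn b₀ p (L * ℓk)) ‖bgField (B1.aSeq a L (k + 1)) L G Qs ψ x‖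
      ‖negLap (bgField (B1.aSeq a L (k + 1)) L G Qs ψ) x‖) (x : X) :
    ‖ψ (blk x)‖ ≤ (((a * (1 - (L ^ 2)⁻¹))⁻¹ + 1) * L ^ (-(((d : ℝ) - 2) / 2))
          + (a * (1 - (L ^ 2)⁻¹))⁻¹ * (msq * ε₀ ^ 2) * L ^ (2 - ((d : ℝ) - 2) / 2)) * B2.pFn b₀ p (L * ℓk)
      ∧ (((a * (1 - (L ^ 2)⁻¹))⁻¹ + 1) * L ^ (-(((d : ℝ) - 2) / 2))
          + (a * (1 - (L ^ 2)⁻¹))⁻¹ * (msq * ε₀ ^ 2) * L ^ (2 - ((d : ℝ) - 2) / 2)) * B2.pFn b₀ p (L * ℓk)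
        ≤ (((a * (1 - (L ^ 2)⁻¹))⁻¹ + 1) * L ^ (-(((d : ℝ) - 2) / 2))
          + (a * (1 - (L ^ 2)⁻¹))⁻¹ * (msq * ε₀ ^ 2) * L ^ (2 - ((d : ℝ) - 2) / 2)) * B2.pFn b₀ p ℓk := by
  have hL2 : 1 < L ^ 2 := by nlinarith
  have hainf : 0 < a * (1 - (L ^ 2)⁻¹) := mul_pos ha (by rw [sub_pos]; exact inv_lt_one_of_one_lt₀ hL2)
  have hale : a * (1 - (L ^ 2)⁻¹) ≤ B1.aSeq a L (k + 1) := (B1.ainf_lt_aSeq ha hL (k + 1) (by omega)).le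
  have hpp : 0 ≤ B2.pFn b₀ p (L * ℓk) := by
    unfold B2.pFn
    refine mul_nonneg hb₀ (Real.rpow_nonneg ?_ _)
    rw [Real.log_inv]
    have := Real.log_nonpos (by positivity : (0 : ℝ) ≤ L * ℓk) hLℓ
    linarith
  have hL0 : 0 < L := by linarith
  have hc : 0 ≤ ((a * (1 - (L ^ 2)⁻¹))⁻¹ + 1) * L ^ (-(((d : ℝ) - 2) / 2))
      + (a * (1 - (L ^ 2)⁻¹))⁻¹ * (msq * ε₀ ^ 2) * L ^ (2 - ((d : ℝ) - 2) / 2) := by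
    have := hainf.le
    positivity
  exact ⟨ineq352 negLap P G Qs blk d hainf hale hL.le hmsq hℓk.le hℓkε₀ hpp hG hP ψ hiso hchi x,
    ineq352_step hc hb₀ hp hℓk hL.le hLℓ⟩

end Model

/-! ## §4 Reading note on the displayed middle member (two terms) -/

/-- **abstract-model witness** (reading note, HOME/GAPS.md): the displayed inputs of (3.52) — the two restriction bounds of
`χ_{k+1}(ψ)`, the averaging bound for `P`, the isometry of `Q*`, `G⁻¹ = −Δ + aL⁻²P + m²(L^kε)²` — do NOT by themselves give the
displayed TWO-term middle member `a⁻¹L^{−(d−2)/2}p + L^{−(d−2)/2}p` when the mass term is present: one fine and one coarse site,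
`V = ℝ`, `d = 2`, `L = 2`, `a = 1`, `m²(L^kε)² = 1/100`, `p(L^{k+1}ε) = 1`, `−Δ ↦ ¼·id` (saturating `|Δψ^{(k+1)}| ≤ L⁻²p`), `P = id`,
`G = (51/100)⁻¹·id`, `ψ = 51/25`: all hypotheses of `ineq352_three_terms` hold and `|ψ(y)| = 2.04 > 2 =` the two-term member
(the excess is exactly the third term `a⁻¹μL²·p = 4/100`).  A statement about the typed reading, not about lattice Laplacians.
[cite: Balaban1982Higgs1, (3.52) p.621] -/
theorem two_term_member_can_fail :
    ∃ (negLap P G : (Unit → ℝ) →ₗ[ℝ] (Unit → ℝ)) (Qs : (Unit → ℝ) →ₗ[ℝ] (Unit → ℝ)) (a L μ pp : ℝ) (ψ : Unit → ℝ),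
      0 < a ∧ 0 < L ∧ 0 ≤ μ ∧ 0 ≤ pp
      ∧ (∀ f, negLap (G f) + (a * (L ^ 2)⁻¹) • P (G f) + μ • G f = f)
      ∧ (∀ (f : Unit → ℝ) (M : ℝ), (∀ x, ‖f x‖ ≤ M) → ∀ x, ‖P f x‖ ≤ M)
      ∧ (∀ x, ‖Qs ψ x‖ = ‖ψ x‖)
      ∧ (∀ x, SmallFieldAt 2 L pp ‖bgField a L G Qs ψ x‖ ‖negLap (bgField a L G Qs ψ) x‖)
      ∧ ¬ (‖ψ ()‖ ≤ (a⁻¹ * L ^ (-((((2 : ℕ) : ℝ) - 2) / 2)) + L ^ (-((((2 : ℕ) : ℝ) - 2) / 2))) * pp) := by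
  refine ⟨(1 / 4 : ℝ) • LinearMap.id, LinearMap.id, (100 / 51 : ℝ) • LinearMap.id, LinearMap.id, 1, 2, 1 / 100, 1,
    fun _ => 51 / 25, one_pos, two_pos, by norm_num, zero_le_one, ?_, ?_, fun _ => rfl, ?_, ?_⟩
  · intro f
    ext u
    simp only [LinearMap.smul_apply, LinearMap.id_coe, id_eq, Pi.add_apply, Pi.smul_apply, smul_eq_mul]
    ring
  · intro f M hM u
    simpa using hM u
  · intro u
    have hbg : bgField (1 : ℝ) 2 ((100 / 51 : ℝ) • (LinearMap.id : (Unit → ℝ) →ₗ[ℝ] (Unit → ℝ)))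
        (LinearMap.id : (Unit → ℝ) →ₗ[ℝ] (Unit → ℝ)) (fun _ : Unit => (51 / 25 : ℝ)) = fun _ => 1 := by
      ext v
      simp only [bgField, LinearMap.smul_apply, LinearMap.id_coe, id_eq, Pi.smul_apply, smul_eq_mul]
      norm_num
    rw [hbg]
    refine ⟨?_, ?_⟩
    · simp only [norm_one, Nat.cast_ofNat, sub_self, zero_div, neg_zero, Real.rpow_zero, one_mul, le_refl]
    · simp only [LinearMap.smul_apply, LinearMap.id_coe, id_eq, Pi.smul_apply, smul_eq_mul, mul_one, Nat.cast_ofNat,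
        Real.norm_eq_abs]
      rw [show (-(((2 : ℝ) + 2) / 2)) = ((-2 : ℤ) : ℝ) by norm_num, Real.rpow_intCast]
      norm_num
  · simp only [Real.norm_eq_abs, Nat.cast_ofNat, sub_self, zero_div, neg_zero, Real.rpow_zero, inv_one, mul_one]
    norm_num

end Literature.MathematicalPhysics.QuantumFieldTheory.Balaban1983to89.B1Ineq352Proof
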